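import Summits.CriticalPhenomena.Ising3DConformalLimit.Theses.MonotoneRG
import Summits.CriticalPhenomena.Ising3DConformalLimit.Theorems.EnergyNotSigmaSquaredMoebiusLimitExistsCompactnessSchema
import HarnessLib

/-!
# Uniform regularity of the pinned zoom ⟹ precompactness of the critical orbit
(item stmt-CriticalPhenomena-14456 `MonotoneRG.RegularityGivesPrecompact`, proved VERBATIM:
`UniformRegularity → OrbitPrecompact`; simultaneously the registered stub
`stub_regularityGivesPrecompact` (step S6) of line `Sketch` of the crux `ExistsScaleCovariantLimit`,
item stmt-CriticalPhenomena-1981)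

`UniformRegularity` (item stmt-4658) says that the critical `ℤ³` Ising correlators, rescaled at mesh
`δ` and renormalised by `ρ★(δ) = ⟨σ₀ σ_{⌊δ⁻¹⌋ e₀}⟩_{β_c}^{-1/2}`, are on every compact set `K` of
non-coincident configurations (a) uniformly bounded and (b) uniformly equicontinuous for all small
`δ`, and (c) at `n = 2` bounded below by a positive constant. `OrbitPrecompact` (item stmt-5955) asks
for SOME renormalisation `ρ > 0` on `(0,1]` such that every mesh sequence `u k → 0` in `(0,1]` has a
subsequence along which, for all `n` at once, the rescaled correlators converge locally uniformly on
`NonCoincident 3 n` to a family with non-degenerate two-point function.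

Proof. Take `ρ := ρ★ = rhoPin` (positive on `(0,1]`, `rhoPin_pos`). Given `u`, since `u k > 0` and
`u → 0`, eventually `u k ∈ (0, δ₀)` for every `δ₀ > 0`, so (a) and (b) are exactly the two hypotheses
(eventual uniform boundedness, asymptotic equicontinuity on compacts) of the landed Arzelà–Ascoli /
Cantor-diagonal schema `compactnessSchema` applied to `F n k := rescaledCorrelator (criticalCorr 3)
rhoPin n (u k)`; it returns one strictly increasing `φ` and a limit family `S` with locally uniform
convergence for every `n`. Non-degeneracy of `S 2`: at `x ∈ NonCoincident 3 2`, clause (c) on the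
compact `{x}` gives `m ≤ F 2 (φ k) x` eventually with `m > 0`, and `F 2 (φ k) x → S 2 x`, so
`0 < m ≤ S 2 x` (`ge_of_tendsto`).

No lattice input beyond the hypothesis; no named unproved fact. References: folklore
(Arzelà–Ascoli with a diagonal subsequence), `compactnessSchema`, `rhoPin_pos`.
-/

noncomputable section

open Filter Topology Set
open Literature.Probability.LatticeModels
open Summit.CriticalPhenomena.Ising3DConformalLimit.MoebiusLimitExistsOnlyInteraction
  (rhoPin rhoPin_pos compactnessSchema)

namespace Summit.CriticalPhenomena.Ising3DConformalLimit.Cruxes.ExistsScaleCovariantLimit.TwoHierarchies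

/-- The renormalisation written inline in `UniformRegularity`,
`δ ↦ ⟨σ₀ σ_{⌊δ⁻¹⌋ e₀}⟩_{β_c}^{-1/2}`, is the pinned renormalisation `rhoPin`
(`rhoPin δ = ⟨σ₀ σ_{⌊1/δ⌋ e₀}⟩_{β_c}^{-1/2}`, and `1/δ = δ⁻¹`). [folklore] -/
theorem rhoStar_eq_rhoPin :
    (fun δ : ℝ => (criticalTwoPoint 3 (Pi.single 0 ⌊δ⁻¹⌋)) ^ (-(1/2:ℝ))) = rhoPin := by
  funext δ
  simp only [rhoPin, one_div]

/-- A sequence with values in `(0,1]` tending to `0` is eventually in `(0, δ₀)` for every `δ₀ > 0`.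
[folklore] -/
theorem eventually_mem_Ioo_of_tendsto_zero {u : ℕ → ℝ} (hu0 : ∀ k, u k ∈ Set.Ioc (0:ℝ) 1)
    (hu : Tendsto u atTop (𝓝 0)) {δ₀ : ℝ} (hδ₀ : 0 < δ₀) :
    ∀ᶠ k in atTop, u k ∈ Set.Ioo 0 δ₀ :=
  ((tendsto_order.1 hu).2 δ₀ hδ₀).mono fun k hk => ⟨(hu0 k).1, hk⟩

/-- **S6 = item stmt-CriticalPhenomena-14456 verbatim: `UniformRegularity → OrbitPrecompact`.**
With `ρ := rhoPin` (the inline `ρ★` of `UniformRegularity`), clauses (a) uniform bounds and (b)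
uniform equicontinuity on compacts of non-coincident configurations, valid for `δ ∈ (0, δ₀)`, hold
eventually along any mesh sequence `u k → 0` in `(0,1]`; the Arzelà–Ascoli/diagonal schema
`compactnessSchema` then yields one subsequence `φ` and a limit family `S` with locally uniform
convergence on `NonCoincident 3 n` for every `n`, and clause (c) (positive lower bound at `n = 2` on
the compact `{x}`) passes to the limit, giving `0 < S 2 x` off the diagonal. [folklore] -/
theorem stub_regularityGivesPrecompact :
    Summit.CriticalPhenomena.Ising3DConformalLimit.Theses.MonotoneRG.RegularityGivesPrecompact := by
  unfold Summit.CriticalPhenomena.Ising3DConformalLimit.Theses.MonotoneRG.RegularityGivesPrecompact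
    Summit.CriticalPhenomena.Ising3DConformalLimit.Theses.MonotoneRG.UniformRegularity
    Summit.CriticalPhenomena.Ising3DConformalLimit.Theses.MonotoneRG.OrbitPrecompact
  intro hUR
  rw [rhoStar_eq_rhoPin] at hUR
  obtain ⟨hab, hc⟩ := hUR
  refine ⟨rhoPin, rhoPin_pos, ?_⟩
  intro u hu0 hu
  -- the mesh sequence is eventually below every `δ₀ > 0`
  have hev : ∀ {δ₀ : ℝ}, 0 < δ₀ → ∀ᶠ k in atTop, u k ∈ Set.Ioo 0 δ₀ := fun hδ₀ =>
    eventually_mem_Ioo_of_tendsto_zero hu0 hu hδ₀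
  -- (a) ⟹ eventual uniform boundedness on compacts
  have hB : ∀ (n : ℕ) (K : Set (Fin n → EuclideanSpace ℝ (Fin 3))), IsCompact K →
      K ⊆ NonCoincident 3 n → ∃ B : ℝ, ∀ᶠ k in atTop, ∀ x ∈ K,
        |rescaledCorrelator (criticalCorr 3) rhoPin n (u k) x| ≤ B := by
    intro n K hK hKU
    obtain ⟨M, δ₀, hδ₀, hbd⟩ := (hab n K hKU hK).1
    exact ⟨M, (hev hδ₀).mono fun k hk x hx => hbd _ hk x hx⟩
  -- (b) ⟹ asymptotic equicontinuity on compacts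
  have hE : ∀ (n : ℕ) (K : Set (Fin n → EuclideanSpace ℝ (Fin 3))), IsCompact K →
      K ⊆ NonCoincident 3 n → ∀ ε > 0, ∃ η > 0, ∀ᶠ k in atTop, ∀ x ∈ K, ∀ y ∈ K, dist x y < η →
        |rescaledCorrelator (criticalCorr 3) rhoPin n (u k) x -
          rescaledCorrelator (criticalCorr 3) rhoPin n (u k) y| < ε := by
    intro n K hK hKU ε hε
    obtain ⟨r, δ₀, hr, hδ₀, heq⟩ := (hab n K hKU hK).2 ε hε
    exact ⟨r, hr, (hev hδ₀).mono fun k hk x hx y hy hxy => heq _ hk x hx y hy hxy⟩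
  -- the Arzelà–Ascoli / diagonal schema
  obtain ⟨φ, S, hφ, -, -, hconv⟩ :=
    compactnessSchema (fun n k => rescaledCorrelator (criticalCorr 3) rhoPin n (u k)) hB hE
  refine ⟨φ, S, hφ, ?_, hconv⟩
  -- (c) ⟹ non-degeneracy of the limiting two-point function
  intro x hx
  obtain ⟨m, δ₀, hm, hδ₀, hlow⟩ := hc {x} (Set.singleton_subset_iff.2 hx) isCompact_singleton
  have hevφ : ∀ᶠ k in atTop, m ≤ rescaledCorrelator (criticalCorr 3) rhoPin 2 (u (φ k)) x :=
    (hφ.tendsto_atTop.eventually (hev hδ₀)).mono fun k hk => hlow _ hk x (Set.mem_singleton x)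
  have ht : Tendsto (fun k => rescaledCorrelator (criticalCorr 3) rhoPin 2 (u (φ k)) x) atTop
      (𝓝 (S 2 x)) :=
    (hconv 2).tendsto_at hx
  exact lt_of_lt_of_le hm (ge_of_tendsto ht hevφ)

/-- item stmt-CriticalPhenomena-14456: `MonotoneRG.RegularityGivesPrecompact`
(`UniformRegularity → OrbitPrecompact`), literally. [folklore] -/
theorem regularityGivesPrecompact_proof :
    Summit.CriticalPhenomena.Ising3DConformalLimit.Theses.MonotoneRG.RegularityGivesPrecompact :=
  stub_regularityGivesPrecompact

end Summit.CriticalPhenomena.Ising3DConformalLimit.Cruxes.ExistsScaleCovariantLimit.TwoHierarchies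

end
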